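import Mathlib
import HarnessLib
import Summits.Langlands.Langlands.Statement
import Literature.NumberTheory.GaloisRepresentations.ToLocalRestrictField
import Literature.NumberTheory.Automorphic.HLTTCompatible
import Literature.RepresentationTheory.Semisimple.SubrepresentationEquiv

/-!
# Crux `EisensteinSeededLifting` (route `EisensteinDegreeShift`, item stmt-Langlands-18369), line `birth`:
# stub `stub_conjInvariance` — frame invariance of the sector hypotheses and of the Satake conclusion

Support file (`--supports stmt-Langlands-18369`) proving the registered stub `stub_conjInvariance` of the
checked skeleton `Cruxes/EisensteinSeededLifting/Lines/birth.lean` VERBATIM.  For a framed Galois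
representation `ρ : Γ_K → GL_n(ℚ̄_p)` and a change of frame `ρ' = P ρ P⁻¹` (`FramedRep.conj P ρ`):

* irreducibility on `ℚ̄_pⁿ` passes from `ρ` to `ρ'` (the linear automorphism `v ↦ P v` intertwines the
  two representations; `Representation.isIrreducible_of_equiv` of
  `Literature/RepresentationTheory/Semisimple/SubrepresentationEquiv`), packaged as the iff
  `isIrreducible_conj_iff`;
* unramifiedness at `v` passes (`FramedGaloisRep.isUnramifiedAt_conj_iff`, `GaloisRep.lean`);
* at `v ∣ p`, crystallinity for Fontaine's PINNED datum `fontainePstAdicCompletion v p hv` passes and the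
  `τ`-labelled Hodge–Tate multisets agree for every ring hom `τ : K_v →+* ℚ̄_p`
  (`PstWeilDeligneData.isCrystallineFramed_conj_iff`, `PstWeilDeligneData.labelledHodgeTateWeights_conj_eq`
  of `ToLocalRestrictField`, after `FramedGaloisRep.toLocal_conj : (P ρ P⁻¹)|_{Γ_{K_v}} = P ρ|_{Γ_{K_v}} P⁻¹`);
* the summit's `SatakeFrobCompatibleAt ι π ρ' v` descends to `ρ` (unramifiedness as above, and the
  Frobenius characteristic polynomial does not see the frame, `HLTT.hasFrobCharpolyAt_conj_iff`).

Everything is proved from landed tree lemmas; axioms ⊆ {propext, Classical.choice, Quot.sound}.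
Pure representation-theoretic bookkeeping: no lifting, no automorphy. [folklore]
-/

set_option linter.dupNamespace false -- Summit.Langlands.Langlands is the mandated namespace

namespace Summit.Langlands.Langlands.Cruxes.EisensteinSeededLifting.Birth

open scoped MatrixGroups Matrix
open Literature.NumberTheory.GaloisRepresentations Literature.NumberTheory.PAdicHodge

section Conj

variable {G : Type*} [Group G] [TopologicalSpace G] {A : Type*} [Field A] [TopologicalSpace A]
  [IsTopologicalRing A] {n : ℕ}

/-- **Irreducibility on `Aⁿ` does not see the frame**: `P ρ P⁻¹` is irreducible iff `ρ` is.
Multiplication by `Q` is an equivalence `σ.toRepresentation ≃ (Q σ Q⁻¹).toRepresentation`, and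
irreducibility is transported along equivalences (`Representation.isIrreducible_of_equiv`); the converse
is the case `Q = P⁻¹`, `σ = P ρ P⁻¹` (`FramedRep.conj_inv_conj_eq`). [folklore] -/
theorem isIrreducible_conj_iff (ρ : FramedRep G A n) (P : GL (Fin n) A) :
    (FramedRep.conj P ρ).IsIrreducible ↔ ρ.IsIrreducible := by
  suffices key : ∀ (σ : FramedRep G A n) (Q : GL (Fin n) A),
      σ.IsIrreducible → (FramedRep.conj Q σ).IsIrreducible by
    refine ⟨fun h => ?_, key ρ P⟩
    simpa only [FramedRep.conj_inv_conj_eq] using key (FramedRep.conj P ρ) P⁻¹ h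
  intro σ Q h
  haveI : Representation.IsIrreducible (FramedRep.toRepresentation σ) := h
  change Representation.IsIrreducible (FramedRep.toRepresentation (FramedRep.conj Q σ))
  refine Literature.RepresentationTheory.Semisimple.Representation.isIrreducible_of_equiv
    (ρ := FramedRep.toRepresentation σ) (σ := FramedRep.toRepresentation (FramedRep.conj Q σ))
    (Representation.Equiv.mk (Matrix.GeneralLinearGroup.toLin Q).toLinearEquiv fun g => ?_)
  refine LinearMap.ext fun v => ?_
  change (Q : Matrix (Fin n) (Fin n) A) *ᵥ (((σ g : GL (Fin n) A) : Matrix (Fin n) (Fin n) A) *ᵥ v) =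
    ((FramedRep.conj Q σ g : GL (Fin n) A) : Matrix (Fin n) (Fin n) A) *ᵥ
      ((Q : Matrix (Fin n) (Fin n) A) *ᵥ v)
  rw [FramedRep.conj_apply, Units.val_mul, Units.val_mul, Matrix.mulVec_mulVec, Matrix.mulVec_mulVec,
    Matrix.mul_assoc, Matrix.mul_assoc, Units.inv_mul, Matrix.mul_one]

end Conj

/-- **Registered stub `stub_conjInvariance`** of `Lines/birth.lean` (crux `EisensteinSeededLifting`,
stmt-Langlands-18369): for `ρ' = P ρ P⁻¹`, irreducibility, unramifiedness at every `v`, crystallinity at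
`v ∣ p` for the pinned Fontaine datum together with the `τ`-labelled Hodge–Tate multisets, all pass from
`ρ` to `ρ'`, and Satake–Frobenius compatibility with any cuspidal `π` passes back from `ρ'` to `ρ`
(`isIrreducible_conj_iff`, `FramedGaloisRep.isUnramifiedAt_conj_iff`, `FramedGaloisRep.toLocal_conj`,
`PstWeilDeligneData.isCrystallineFramed_conj_iff`, `PstWeilDeligneData.labelledHodgeTateWeights_conj_eq`,
`HLTT.hasFrobCharpolyAt_conj_iff`). [folklore] -/
theorem stub_conjInvariance : ∀ (K : Type) [Field K] [NumberField K] (n : ℕ) (p : ℕ) [Fact p.Prime] (hcpt : Literature.NumberTheory.Automorphic.isCompact_glFiniteIntegralLevel n K) (ι : PadicAlgCl p ≃+* ℂ) (ρ ρ' : Literature.NumberTheory.GaloisRepresentations.FramedGaloisRep K (PadicAlgCl p) n) (P : GL (Fin n) (PadicAlgCl p)), ρ' = Literature.NumberTheory.GaloisRepresentations.FramedRep.conj P ρ → (ρ.toGaloisRep.IsIrreducible → ρ'.toGaloisRep.IsIrreducible) ∧ (∀ v : IsDedekindDomain.HeightOneSpectrum (NumberField.RingOfIntegers K), ρ.IsUnramifiedAt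 v → ρ'.IsUnramifiedAt v) ∧ (∀ (v : IsDedekindDomain.HeightOneSpectrum (NumberField.RingOfIntegers K)) (hv : ((p : ℕ) : NumberField.RingOfIntegers K) ∈ v.asIdeal), ((Literature.NumberTheory.PAdicHodge.fontainePstAdicCompletion v p hv).IsCrystallineFramed (ρ.toLocal v) → (Literature.NumberTheory.PAdicHodge.fontainePstAdicCompletion v p hv).IsCrystallineFramed (ρ'.toLocal v)) ∧ (∀ τ : v.adicCompletion K →+* PadicAlgCl p, ρ'.labelledHodgeTateWeightsAt v (Literature.NumberTheory.PAdicHodge.fontainePstAdicCompletion v p hv).algebra (Literature.NumberTheory.PAdicHodge.fontainePstAdicCompletion v p hv).𝔅 τ = ρ.labelledHodgeTateWeightsAt v (Literature.NumberTheory.PAdicHodge.fontainePstAdicCompletion v p hv).algebra (Literature.NumberTheory.PAdicHodge.fontainePstAdicCompletion v p hv).𝔅 τ)) ∧ (∀ (π : Literature.NumberTheory.Automorphic.CuspidalAutomorphicRepData n K hcpt) (v : IsDedekindDomain.HeightOneSpectrum (NumberField.RingOfIntegers K)), Summit.Langlands.SatakeFrobCompatibleAt ι π.1 ρ' v → Summit.Langlands.SatakeFrobCompatibleAt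 ι π.1 ρ v) := by
  intro K _ _ n p _ hcpt ι ρ ρ' P hρ'
  subst hρ'
  refine ⟨fun h => (isIrreducible_conj_iff ρ P).mpr h, fun v h => (FramedGaloisRep.isUnramifiedAt_conj_iff v P ρ).mpr h,
    fun v hv => ⟨fun h => ?_, fun τ => ?_⟩, ?_⟩
  · rw [FramedGaloisRep.toLocal_conj, PstWeilDeligneData.isCrystallineFramed_conj_iff]
    exact h
  · rw [FramedGaloisRep.labelledHodgeTateWeightsAt_def, FramedGaloisRep.labelledHodgeTateWeightsAt_def,
      FramedGaloisRep.toLocal_conj, PstWeilDeligneData.labelledHodgeTateWeights_conj_eq]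
  · rintro π v ⟨α, hα, hunr, hchar⟩
    exact ⟨α, hα, (FramedGaloisRep.isUnramifiedAt_conj_iff v P ρ).mp hunr,
      (Literature.NumberTheory.Automorphic.HLTT.hasFrobCharpolyAt_conj_iff v P _ ρ).mp hchar⟩

end Summit.Langlands.Langlands.Cruxes.EisensteinSeededLifting.Birth
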